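import Summits.CriticalPhenomena.SAWScalingLimit.Theorems.SAWLeftRightFKGLeftRightFKGReduction

/-!
# Strategist r1 — typed forms of the strengthenings examined in STRATEGY-CENSUS-r1.md (crux stmt-CriticalPhenomena-11232)

`Corner x` / `CornerCritical` / `PA x` are the landed vocabulary of line corner-localisation
(`…Theorems.LeftRightFKG.CornerLoc`, p86990/p98583).  Nothing here is claimed proved except the two one-line glue facts.
-/

namespace Summit.CriticalPhenomena.SAWScalingLimit.Cruxes.LeftRightFKG.StrategistR1

open Summit.CriticalPhenomena.SAWScalingLimit.Theorems.LeftRightFKG.CornerLoc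
open Literature.Probability.RandomPlanarGeometry

/-- S13 `CornerSubcritical` (whole-interval form): corner positivity at EVERY subcritical fugacity.  With the landed
closedness-from-below (p110186/p126611 pattern) it gives `CornerCritical`; census: alive (0 sign changes on (0,x_c] in
6.0e6 exact minors) but a strengthening containing the crux. [folklore] -/
def CornerSubcritical : Prop :=
  ∀ x : ℝ, 0 < x → x < SAW.criticalFugacity → Corner x

/-- S12/T16 in UNIFORM form, `CornerSmallFugacity`: a fugacity `x₁ > 0` below which corner positivity holds in EVERY
instance.  Instance-wise it is the geodesic Lindström–Gessel–Viennot sign (census T16, exact on all animals ≤ 12 sites);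
the uniform form is open (no uniform radius: the first tie-breaking order meets the switching remainder). [folklore] -/
def CornerSmallFugacity : Prop :=
  ∃ x₁ : ℝ, 0 < x₁ ∧ ∀ x : ℝ, 0 < x → x ≤ x₁ → Corner x

/-- S11 `CornerMonotoneDown` (the form that would make S13 equivalent to the crux): corner positivity is inherited
downwards in the fugacity.  Census: monotonicity of individual covariances is REFUTED above `x_c` (s2 S10, re-entrant
windows) and unproved below; recorded as the missing link, not conjectured. [folklore] -/
def CornerMonotoneDown : Prop :=
  ∀ x y : ℝ, 0 < y → y ≤ x → Corner x → Corner y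

/-- glue for D-o / S13: the whole-interval form plus closedness from below gives the crux's content. [folklore] -/
theorem cornerCritical_of_subcritical_of_closed
    (hclosed : (∀ x : ℝ, 0 < x → x < SAW.criticalFugacity → Corner x) → CornerCritical)
    (h : CornerSubcritical) : CornerCritical :=
  hclosed h

/-- glue: monotonicity would reduce the whole-interval form to the crux. [folklore] -/
theorem cornerSubcritical_of_monotone (hm : CornerMonotoneDown) (hc : CornerCritical) : CornerSubcritical :=
  fun x hx hlt => hm SAW.criticalFugacity x hx hlt.le hc

end Summit.CriticalPhenomena.SAWScalingLimit.Cruxes.LeftRightFKG.StrategistR1
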